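import Literature.MathematicalPhysics.QuantumFieldTheory.Balaban1983to89.B11Rem287U0Analytic
import Literature.MathematicalPhysics.QuantumFieldTheory.Balaban1983to89.B7Prop7Ck
import Literature.MathematicalPhysics.QuantumFieldTheory.Balaban1983to89.B11Eq44Concrete
import Literature.MathematicalPhysics.QuantumFieldTheory.Balaban1983to89.B11Prop3Model

/-!
# `Balaban1983to89.B11Rem287U0Concrete` — T. Bałaban, *The variational problem and background fields in renormalization group method
for lattice gauge theories*, Commun. Math. Phys. **102** (1985) 277–309 [Balaban1985Variational], the second remark of p. 287: **«it is easy
to see that it [D(A′)] is an analytic function of U₀, because the averaging operations Q_j(U₀, ηA) and the operator H(U₀) are analytic in U₀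
… so D(A′) has the same analyticity domain as H(U₀)»** — THE `Q_j`-LETTER DISCHARGED FOR THE CONCRETE `C_j(U₀, ·)` OF [4] ON THE `ℤᵈ`
CARRIER, in the complex chart `u ↦ e^{A′}U₀` (`A′ = ins_{S′} u`) of [4] Proposition 7 («Q_k(U′U₀, ηA) is analytic in complex variables A′, A,
and Proposition 4 holds uniformly in A′»), and r08's scheme `B11Rem287U0Analytic` (joint analyticity of the fixed point by the analytic
implicit function theorem) INSTANTIATED at these data: `U₀ ↦ D(U₀, A′)` is analytic on the whole analyticity domain of `H(U₀)` inside the chart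

statement-level skeleton of published theorems with citation tags; proofs where landed; nothing here is a claim about the Yang–Mills mass gap

v1.1 (p06 gen 17, 2026-08-23): DOCFIX ONLY — the «THE PRINT (p. 287)» quotation below re-typed VERBATIM from the page (render `…-p011-x2.png`
read as image, text layer `p0011.txt` L25–30): v1 opened it with words of ours («The definition of the function D(A′) implies that …»,
«Also …») inside the guillemets — r11 second-read note Q6-1 (`lit-balaban-r11/SECOND-READ-B11.md` §6, row B11.Rem@287); declarations
byte-identical.

PDF held: `paper:balaban1985-cmp102-variational-background` (journal page = PDF page + 276); p. 287 [PDF 11], render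
`run/shared/lean/pub/pub-balaban/b2b-balaban-ref1/pages/1985-cmp102-variational-background/…-p011-x2.png` (read as image by the cell; the
sentence is quoted in `B11Rem287U0Analytic`); [4] = [Balaban1985Averaging] Proposition 7 p. 43, Proposition 4 (130)–(136) pp. 38–39.

CITATION HEADER / WHAT IS REPRODUCED.  Cell `lit-balaban`, Phase-2 proof seat p06 gen 7 = unit `lit-balaban-p06` (TAKING line HOME/STATUS.md
2026-08-21, gen 7, #4); SKELETON row **B11.Rem@287** (owner r08: `proved p298078` = `B11Rem287U0Analytic`, the remark at the Sect. C SCHEME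
level — data `C : 𝒰 → 𝒴 → 𝒳` jointly analytic on `𝒪 ×ˢ {‖Y‖ < R}` with `‖C(U₀, Y)‖ ≤ C₂‖Y‖²`, `H : 𝒰 → (𝒳 →L 𝒴)` analytic on `𝒪` with
`‖H(U₀)‖ ≤ B₀`; its HONEST SCOPE: «no lattice object is constructed (the concrete `C_j` on ℤᵈ is `B11Eq44Concrete.Cmap` at a FIXED background;
its U₀-analyticity is not in the tree)»).  THIS FILE supplies that U₀-analyticity and the instance.  THE PRINT (p. 287, the whole paragraph,
verbatim): *«A second remark concerns regularity properties of D(A′). We know that it is an analytic function of A′ for 𝔤ᶜ valued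
configurations A′ satisfying |A′|₍₋₁₎ < ε₃. It is a function of the configuration U₀ also, and it is easy to see that it is an analytic
function of U₀, because the averaging operations Q_j(U₀, ηA) and the operator H(U₀) are analytic in U₀. The analyticity domain is smaller
for H(U₀) and was described in [5], so D(A′) has the same analyticity domain as H(U₀).»*; [4] p. 43: *«Proposition 7. For U₀ satisfying (52) and U′ = e^{iηA′}, |A′| < α₁, α₀, α₁ sufficiently
small, the function Q_k(U′U₀, ηA) is analytic in complex variables A′, A, and Proposition 4 holds uniformly in A′.»*

DICTIONARY.  Background chart (reading (M1) of `B11Rem287U0Analytic`: «analytic in U₀» = holomorphic in a complex chart): `𝒰 := 𝔸^{S′}`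
(`S′` a finite bond set), `u ↦ U′U₀ = e^{ins_{S′} u}·U₀` (`B7Prop3Flat.expCfg (insCfg S′ u) * U₀`, the chart of [4] Prop. 7 / `B7Prop7Ins`),
parameter domain `𝒪 := {u | ‖u‖ < ρ′}` (sup norm; print's «|A′| < α₁»); field space `𝒴 := 𝔸^{S}`, radius `R := ρ`; values `𝒳 := 𝔸^{T}`;
`C u Y := Cmap L (e^{ins u}U₀) S T j Y = (C_j(e^{ins u}U₀, ins_S Y)(c))_{c∈T}` (`B11Eq44Concrete.Cmap`, `CCovIter = logCovIter − linCovIter`);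
`C₂ := 8C₁′e^{E(ρ′)}(Lʲ)²` with `C₁′ = 2097152(d+1)²`, `E(ρ′) = 4480(d+1)²(d+4)α₀ + 240000(d+1)³Lᵏρ′` ([4] (130) uniformly in `A′`,
`B7Prop7Ins.prop7_prop4_uniform_ins`); `H : 𝔸^{S′} → (𝔸^T →L 𝔸^S)` ABSTRACT with its two letters `hHa` (analytic on `𝒪`), `hHB` (`‖H(u)‖ ≤ B₀`)
— [5]'s object, hypotheses exactly as in `B11Rem287U0Analytic`.  Regime: the DATA of `B7Prop7Ins` (§Polydisc: `2 ≤ L`, `U₀` regular in an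
averaging-closed `G`, (52) `pdev U₀ < α₀L^{−2k}`, `8α₀ ≤ c₂′`, the five smallness inequalities in `ρ′`, `ρ`), levels `j ≤ k`.

WHAT THIS FILE PROVES (theorems only; kernel, 0 sorry, standard axioms).
* §1 JOINT ANALYTICITY IN (BACKGROUND, FIELD): `analyticOnNhd_logCovIter₂` ([4] Prop. 7 = `B7Prop7Ins.prop7_analyticOnNhd_ins` on
  `𝒪 ×ˢ {‖Y‖ < ρ}`); **`linCovIter₂_eq_fderiv`** (the composed linear part `LʲηQ_j(U′U₀)·ins_S Y` IS the partial Fréchet derivative in the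
  field at `Y = 0` of the jointly analytic `Q_j`: `= D Q̂(u, 0)(0, Y)`, by `B7Prop7Ck.hasFDerivAt_logCovIter_cplx_ins` + uniqueness);
  **`analyticOnNhd_linCovIter₂`** (hence `(u, Y) ↦ LʲηQ_j(e^{ins u}U₀)·ins_S Y` is jointly analytic on `𝒪 × 𝔸^S`: derivative of an analytic map,
  evaluated bilinearly); **`analyticOnNhd_Cmap₂`** — `(u, Y) ↦ C_j(e^{ins u}U₀, ins_S Y)` is jointly analytic on `𝒪 ×ˢ {‖Y‖ < ρ}` = the letter
  `hCa` of `B11Rem287U0Analytic` for the concrete `C_j`.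
* §2 **`norm_Cmap₂_le`** — `‖C_j(e^{ins u}U₀, ins_S Y)‖ ≤ C₂‖Y‖²` uniformly in `u ∈ 𝒪` ((44)/(135) «uniformly in A′») = the letter `hquad`;
  `quadAnalytic_Cmap₂` (each background of the chart is a `QuadAnalytic` datum of `B13Contraction113`).
* §3 THE REMARK FOR THE CONCRETE `C_j`, `H` ABSTRACT: **`analyticOnNhd_D_concrete`** (any selector family `D` with (49)+(55) on
  `𝒪 ×ˢ {‖A′‖ < ε}` is jointly analytic there), **`analyticOnNhd_D_background_concrete`** («an analytic function of U₀» on the whole `𝒪` =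
  «the same analyticity domain as H(U₀)»), `analyticOnNhd_D_field_concrete`, `exists_D_concrete`, and for r08's canonical selector
  **`analyticOnNhd_Dfix_background_concrete`**: `u ↦ B11Prop3Model.Dfix (Cmap L (e^{ins u}U₀) S T j) (H u) C₂ A′` is analytic on `𝒪`
  (regime «9C₂B₀ε < 1», `3ε ≤ ρ`).
NOT CLAIMED: the analyticity of `U₀ ↦ H(U₀)` and its domain ([5] Sect. E — hypothesis); charts other than `e^{A′}U₀` with `A′` on a finite bond
set; uniformity of `B₀` beyond the hypothesis.  NOT summit progress.
-/

noncomputable section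

open scoped BigOperators Topology
open NormedSpace Metric Set Filter

namespace Literature.MathematicalPhysics.QuantumFieldTheory.Balaban1983to89.B11Rem287U0Concrete

open B7Prop1Explicit B7Prop2Explicit B7Prop3Flat B7Prop3GeneralLinear B7Prop4GeneralLevels B7Prop5GeneralInduction
  B7Prop7Levels B7Prop7Ins B7Prop7Ck B11Eq44Concrete B11Rem287U0Analytic B13Contraction113 B12Lineariz267
open B11Prop3Model (Dfix Dfix_ball Dfix_fix)

-- `Site` alone would resolve to the torus sites of `Setup.lean`; re-export the `ℤ^d` sites of `B7Prop1Explicit`.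
export B7Prop1Explicit (Site)

variable {d : ℕ}

variable {𝔸 : Type*} [NormedRing 𝔸] [NormedAlgebra ℂ 𝔸] [CompleteSpace 𝔸] [NormOneClass 𝔸]

section Polydisc

variable (S' S T : Finset (Site d × Fin d)) (L : ℕ) (hL : 2 ≤ L) {G : Subgroup 𝔸ˣ} (hG : AvgClosed d L G) (k : ℕ)
  (U₀ : Site d → Fin d → 𝔸ˣ) (hU₀ : ∀ x κ, U₀ x κ ∈ G) {α₀ : ℝ} (hα : 0 < α₀)
  (hα3 : C0 d * α₀ ≤ 1 / 3) (hα8 : 8 * α₀ ≤ c2' d L) (h52 : pdev U₀ < α₀ * (((L : ℝ) ^ k)⁻¹) ^ 2)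
  {ρ' ρ : ℝ} (hρ' : 0 < ρ') (hρ : 0 < ρ)
  (hsmall' : Real.exp (4 * (800 * ((d : ℝ) + 1) ^ 2 * ((d : ℝ) + 4)) * α₀)
    * (1 + 8 * (131072 * ((d : ℝ) + 1) ^ 2) * ((L : ℝ) ^ k * ρ')) ≤ 2)
  (hc₃' : 2 * ((L : ℝ) ^ k * ρ') ≤ c3 d L) (hρ'1 : 409600 * ((d : ℝ) + 1) ^ 2 * ((L : ℝ) ^ k * ρ') ≤ 1)
  (hsmall : Real.exp (4480 * ((d : ℝ) + 1) ^ 2 * ((d : ℝ) + 4) * α₀ + 240000 * ((d : ℝ) + 1) ^ 3 * ((L : ℝ) ^ k * ρ'))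
    * (1 + 8 * (2097152 * ((d : ℝ) + 1) ^ 2) * ((L : ℝ) ^ k * ρ)) ≤ 2)
  (hc₃ : 2 * ((L : ℝ) ^ k * ρ) ≤ c3 d L / 4)

/-! ## §0 The level-`j` letters (bookkeeping) -/

omit [NormedAlgebra ℂ 𝔸] [CompleteSpace 𝔸] [NormOneClass 𝔸] in
include hL hα hρ h52 hsmall' hc₃' hρ'1 hsmall hc₃ in
/-- the DATA at level `j ≤ k` and at the `A′`-radius `‖u‖ < ρ′` (monotonicity in `Lʲ ≤ Lᵏ` and in the radius, `B7Prop7Ins.smallness7_mono`).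
[cite: Balaban1985Averaging, Proposition 7 p.43] -/
private theorem letters_level {j : ℕ} (hj : j ≤ k) {u : S' → 𝔸} (hu : ‖u‖ < ρ') :
    pdev U₀ < α₀ * (((L : ℝ) ^ j)⁻¹) ^ 2 ∧
      Real.exp (4 * (800 * ((d : ℝ) + 1) ^ 2 * ((d : ℝ) + 4)) * α₀)
          * (1 + 8 * (131072 * ((d : ℝ) + 1) ^ 2) * ((L : ℝ) ^ j * ‖u‖)) ≤ 2 ∧
      2 * ((L : ℝ) ^ j * ‖u‖) ≤ c3 d L ∧ 409600 * ((d : ℝ) + 1) ^ 2 * ((L : ℝ) ^ j * ‖u‖) ≤ 1 ∧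
      Real.exp (4480 * ((d : ℝ) + 1) ^ 2 * ((d : ℝ) + 4) * α₀ + 240000 * ((d : ℝ) + 1) ^ 3 * ((L : ℝ) ^ j * ‖u‖))
          * (1 + 8 * (2097152 * ((d : ℝ) + 1) ^ 2) * ((L : ℝ) ^ j * ρ)) ≤ 2 ∧
      2 * ((L : ℝ) ^ j * ρ) ≤ c3 d L / 4 := by
  obtain ⟨hs', hc', h1', hs, hc⟩ := smallness7_mono (d := d) (L := L) (k := k) (α₀ := α₀) hu.le hρ.le le_rfl
    hsmall' hc₃' hρ'1 hsmall hc₃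
  have hL1 : (1 : ℝ) ≤ (L : ℝ) := by exact_mod_cast le_trans (by norm_num) hL
  have hLjk : (L : ℝ) ^ j ≤ (L : ℝ) ^ k := pow_le_pow_right₀ hL1 hj
  have hLj : (0 : ℝ) < (L : ℝ) ^ j := by positivity
  have hmu : (L : ℝ) ^ j * ‖u‖ ≤ (L : ℝ) ^ k * ‖u‖ := mul_le_mul_of_nonneg_right hLjk (norm_nonneg _)
  have hmρ : (L : ℝ) ^ j * ρ ≤ (L : ℝ) ^ k * ρ := mul_le_mul_of_nonneg_right hLjk hρ.le
  have hd1 : (0 : ℝ) ≤ ((d : ℝ) + 1) ^ 2 := by positivity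
  have hd3 : (0 : ℝ) ≤ ((d : ℝ) + 1) ^ 3 := by positivity
  refine ⟨?_, ?_, by linarith, by nlinarith, ?_, by linarith⟩
  · refine h52.trans_le (mul_le_mul_of_nonneg_left ?_ hα.le)
    have hinv : ((L : ℝ) ^ k)⁻¹ ≤ ((L : ℝ) ^ j)⁻¹ := by
      rw [inv_le_inv₀ (by positivity) hLj]; exact hLjk
    exact pow_le_pow_left₀ (by positivity) hinv 2
  · have hexp : 0 ≤ Real.exp (4 * (800 * ((d : ℝ) + 1) ^ 2 * ((d : ℝ) + 4)) * α₀) := (Real.exp_pos _).le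
    have hfac : 1 + 8 * (131072 * ((d : ℝ) + 1) ^ 2) * ((L : ℝ) ^ j * ‖u‖)
        ≤ 1 + 8 * (131072 * ((d : ℝ) + 1) ^ 2) * ((L : ℝ) ^ k * ‖u‖) := by nlinarith
    exact (mul_le_mul_of_nonneg_left hfac hexp).trans hs'
  · have hE : Real.exp (4480 * ((d : ℝ) + 1) ^ 2 * ((d : ℝ) + 4) * α₀ + 240000 * ((d : ℝ) + 1) ^ 3 * ((L : ℝ) ^ j * ‖u‖))
        ≤ Real.exp (4480 * ((d : ℝ) + 1) ^ 2 * ((d : ℝ) + 4) * α₀ + 240000 * ((d : ℝ) + 1) ^ 3 * ((L : ℝ) ^ k * ‖u‖)) :=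
      Real.exp_le_exp.2 (by nlinarith)
    have hfac : 1 + 8 * (2097152 * ((d : ℝ) + 1) ^ 2) * ((L : ℝ) ^ j * ρ)
        ≤ 1 + 8 * (2097152 * ((d : ℝ) + 1) ^ 2) * ((L : ℝ) ^ k * ρ) := by nlinarith
    have hfac0 : 0 ≤ 1 + 8 * (2097152 * ((d : ℝ) + 1) ^ 2) * ((L : ℝ) ^ j * ρ) := by positivity
    exact (mul_le_mul hE hfac hfac0 (Real.exp_pos _).le).trans hs

/-! ## §1 Joint analyticity in (background, field) of `Q_j`, of its composed linear part, and of the remainder `C_j` -/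

include hL hG hU₀ hα hα3 hα8 h52 hρ' hρ hsmall' hc₃' hρ'1 hsmall hc₃ in
/-- **[4] PROPOSITION 7 ON `𝒪 ×ˢ {‖Y‖ < ρ}`**: `(u, Y) ↦ Q_j(e^{ins u}U₀, ins_S Y)(c)` is jointly analytic, `j ≤ k`
(`B7Prop7Ins.prop7_analyticOnNhd_ins` on the sup-norm polydisc). [cite: Balaban1985Averaging, Proposition 7 p.43] [cite: Balaban1985Variational, p.287] -/
theorem analyticOnNhd_logCovIter₂ {j : ℕ} (hj : j ≤ k) (z : Site d) (κ : Fin d) :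
    AnalyticOnNhd ℂ (fun p : (S' → 𝔸) × (S → 𝔸) => logCovIter L (expCfg (insCfg S' p.1) * U₀) (insCfg S p.2) j z κ)
      ({u : S' → 𝔸 | ‖u‖ < ρ'} ×ˢ {Y : S → 𝔸 | ‖Y‖ < ρ}) := by
  refine (prop7_analyticOnNhd_ins S' S L hL hG k U₀ hU₀ hα hα3 hα8 h52 hρ' hρ hsmall' hc₃' hρ'1 hsmall hc₃ j hj z κ).mono ?_
  rintro p ⟨hp1, hp2⟩
  exact ⟨fun s => lt_of_le_of_lt (norm_le_pi_norm p.1 s) hp1, fun s => lt_of_le_of_lt (norm_le_pi_norm p.2 s) hp2⟩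

include hL hG hU₀ hα hα3 hα8 h52 hρ' hρ hsmall' hc₃' hρ'1 hsmall hc₃ in
/-- **THE COMPOSED LINEAR PART IS THE PARTIAL DERIVATIVE IN THE FIELD**: for `‖u‖ < ρ′`, every `Y ∈ 𝔸^S` and `j ≤ k`,
`LʲηQ_j(e^{ins u}U₀)·(ins_S Y)(c) = D Q̂(u, 0)(0, Y)`, `Q̂(u, Y) := Q_j(e^{ins u}U₀, ins_S Y)(c)` — (134) in Fréchet form at the complex background
(`B7Prop7Ck.hasFDerivAt_logCovIter_cplx_ins`: the field-derivative at `0` IS the composed linear part) and the chain rule for the section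
`Y ↦ (u, Y)` of the jointly analytic `Q̂` (uniqueness of the Fréchet derivative). [cite: Balaban1985Averaging, Proposition 7 p.43, (134) p.38] -/
theorem linCovIter₂_eq_fderiv {j : ℕ} (hj : j ≤ k) (z : Site d) (κ : Fin d) {u : S' → 𝔸} (hu : ‖u‖ < ρ') (Y : S → 𝔸) :
    linCovIter L (expCfg (insCfg S' u) * U₀) (insCfg S Y) j z κ =
      fderiv ℂ (fun p : (S' → 𝔸) × (S → 𝔸) => logCovIter L (expCfg (insCfg S' p.1) * U₀) (insCfg S p.2) j z κ)
        (u, 0) ((0 : S' → 𝔸), Y) := by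
  obtain ⟨h52j, hs', hc', h1', hs, hc⟩ := letters_level S' L hL k U₀ hα h52 hρ hsmall' hc₃' hρ'1 hsmall hc₃ hj hu
  obtain ⟨Λ, hΛF, hΛ⟩ := hasFDerivAt_logCovIter_cplx_ins L hL hG j U₀ hU₀ hα hα3 hα8 h52j (insCfg S' u) (norm_nonneg u)
    (fun x κ' => norm_insCfg_le S' u x κ') hs' hc' h1' hρ hs hc S z κ
  set Qh : (S' → 𝔸) × (S → 𝔸) → 𝔸 := fun p => logCovIter L (expCfg (insCfg S' p.1) * U₀) (insCfg S p.2) j z κ with hQh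
  have hQ : AnalyticAt ℂ Qh (u, 0) :=
    analyticOnNhd_logCovIter₂ S' S L hL hG k U₀ hU₀ hα hα3 hα8 h52 hρ' hρ hsmall' hc₃' hρ'1 hsmall hc₃ hj z κ (u, 0)
      ⟨hu, by simpa using hρ⟩
  have hsec : HasFDerivAt (fun Y' : S → 𝔸 => Qh (u, Y'))
      ((fderiv ℂ Qh (u, 0)).comp (ContinuousLinearMap.inr ℂ (S' → 𝔸) (S → 𝔸))) 0 :=
    hQ.differentiableAt.hasFDerivAt.comp (0 : S → 𝔸) (hasFDerivAt_prodMk_right u (0 : S → 𝔸))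
  have huniq : Λ = (fderiv ℂ Qh (u, 0)).comp (ContinuousLinearMap.inr ℂ (S' → 𝔸) (S → 𝔸)) := hΛF.unique hsec
  rw [← hΛ Y, huniq, ContinuousLinearMap.comp_apply, ContinuousLinearMap.inr_apply]

include hL hG hU₀ hα hα3 hα8 h52 hρ' hρ hsmall' hc₃' hρ'1 hsmall hc₃ in
/-- **THE COMPOSED LINEAR PART `(u, Y) ↦ LʲηQ_j(e^{ins u}U₀)·ins_S Y (c)` IS JOINTLY ANALYTIC** on `𝒪 × 𝔸^S`: it is the Fréchet derivative of the
analytic `Q̂` at `(u, 0)` — analytic in `u` — evaluated at `(0, Y)` (bilinear evaluation); «the averaging operations Q_j(U₀, ηA) … are analytic in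
U₀» for the linear part `Q_j(U₀)`. [cite: Balaban1985Variational, p.287] [cite: Balaban1985Averaging, Proposition 7 p.43] -/
theorem analyticOnNhd_linCovIter₂ {j : ℕ} (hj : j ≤ k) (z : Site d) (κ : Fin d) :
    AnalyticOnNhd ℂ (fun p : (S' → 𝔸) × (S → 𝔸) => linCovIter L (expCfg (insCfg S' p.1) * U₀) (insCfg S p.2) j z κ)
      ({u : S' → 𝔸 | ‖u‖ < ρ'} ×ˢ (univ : Set (S → 𝔸))) := by
  intro p hp
  have hp1 : ‖p.1‖ < ρ' := hp.1
  set Qh : (S' → 𝔸) × (S → 𝔸) → 𝔸 := fun p => logCovIter L (expCfg (insCfg S' p.1) * U₀) (insCfg S p.2) j z κ with hQh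
  -- the analytic replacement `p′ ↦ DQ̂(p′.1, 0)(0, p′.2)`
  have h0 : AnalyticAt ℂ Qh (p.1, 0) :=
    analyticOnNhd_logCovIter₂ S' S L hL hG k U₀ hU₀ hα hα3 hα8 h52 hρ' hρ hsmall' hc₃' hρ'1 hsmall hc₃ hj z κ (p.1, 0)
      ⟨hp1, by simpa using hρ⟩
  have hF : AnalyticAt ℂ (fun p' : (S' → 𝔸) × (S → 𝔸) => fderiv ℂ Qh (p'.1, 0)) p :=
    h0.fderiv.comp_of_eq (analyticAt_fst.prod analyticAt_const) rfl
  have hG' : AnalyticAt ℂ (fun p' : (S' → 𝔸) × (S → 𝔸) => ((0 : S' → 𝔸), p'.2)) p := analyticAt_const.prod analyticAt_snd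
  have happ : AnalyticAt ℂ (fun p' : (S' → 𝔸) × (S → 𝔸) => (fderiv ℂ Qh (p'.1, 0)) ((0 : S' → 𝔸), p'.2)) p :=
    ((ContinuousLinearMap.id ℂ (((S' → 𝔸) × (S → 𝔸)) →L[ℂ] 𝔸)).analyticAt_bilinear _).comp₂ hF hG'
  refine happ.congr ?_
  have hopen : IsOpen {p' : (S' → 𝔸) × (S → 𝔸) | ‖p'.1‖ < ρ'} :=
    isOpen_lt (continuous_norm.comp continuous_fst) continuous_const
  filter_upwards [hopen.mem_nhds hp1] with p' hp'
  exact (linCovIter₂_eq_fderiv S' S L hL hG k U₀ hU₀ hα hα3 hα8 h52 hρ' hρ hsmall' hc₃' hρ'1 hsmall hc₃ hj z κ hp' p'.2).symm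

include hL hG hU₀ hα hα3 hα8 h52 hρ' hρ hsmall' hc₃' hρ'1 hsmall hc₃ in
/-- **`(u, Y) ↦ C_j(e^{ins u}U₀, ins_S Y)(c)` IS JOINTLY ANALYTIC** on `𝒪 ×ˢ {‖Y‖ < ρ}` (`C_j = Q_j − LʲηQ_j`, [4] (134)/(150)).
[cite: Balaban1985Variational, p.287] [cite: Balaban1985Averaging, Proposition 7 p.43, (134)–(136) pp.38–39] -/
theorem analyticOnNhd_CCovIter₂ {j : ℕ} (hj : j ≤ k) (z : Site d) (κ : Fin d) :
    AnalyticOnNhd ℂ (fun p : (S' → 𝔸) × (S → 𝔸) => CCovIter L (expCfg (insCfg S' p.1) * U₀) (insCfg S p.2) j z κ)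
      ({u : S' → 𝔸 | ‖u‖ < ρ'} ×ˢ {Y : S → 𝔸 | ‖Y‖ < ρ}) := fun p hp =>
  (analyticOnNhd_logCovIter₂ S' S L hL hG k U₀ hU₀ hα hα3 hα8 h52 hρ' hρ hsmall' hc₃' hρ'1 hsmall hc₃ hj z κ p hp).sub
    (analyticOnNhd_linCovIter₂ S' S L hL hG k U₀ hU₀ hα hα3 hα8 h52 hρ' hρ hsmall' hc₃' hρ'1 hsmall hc₃ hj z κ p ⟨hp.1, trivial⟩)

include hL hG hU₀ hα hα3 hα8 h52 hρ' hρ hsmall' hc₃' hρ'1 hsmall hc₃ in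
/-- **THE LETTER `hCa` OF `B11Rem287U0Analytic` FOR THE CONCRETE `C_j`**: the family `(u, Y) ↦ Cmap L (e^{ins u}U₀) S T j Y ∈ 𝔸^T` is jointly
analytic on `𝒪 ×ˢ {‖Y‖ < ρ}` — «the averaging operations Q_j(U₀, ηA) … are analytic in U₀» for the nonlinear part `C_j(U₀, ·)` of (44), in the
chart `U′U₀ = e^{A′}U₀`. [cite: Balaban1985Variational, p.287, (44) p.285] [cite: Balaban1985Averaging, Proposition 7 p.43] -/
theorem analyticOnNhd_Cmap₂ {j : ℕ} (hj : j ≤ k) :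
    AnalyticOnNhd ℂ (fun p : (S' → 𝔸) × (S → 𝔸) => Cmap L (expCfg (insCfg S' p.1) * U₀) S T j p.2)
      ({u : S' → 𝔸 | ‖u‖ < ρ'} ×ˢ {Y : S → 𝔸 | ‖Y‖ < ρ}) := by
  intro p hp
  show AnalyticAt ℂ (fun p' : (S' → 𝔸) × (S → 𝔸) => fun c : T =>
    CCovIter L (expCfg (insCfg S' p'.1) * U₀) (insCfg S p'.2) j c.1.1 c.1.2) p
  exact AnalyticAt.pi fun c : T =>
    analyticOnNhd_CCovIter₂ S' S L hL hG k U₀ hU₀ hα hα3 hα8 h52 hρ' hρ hsmall' hc₃' hρ'1 hsmall hc₃ hj c.1.1 c.1.2 p hp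

/-! ## §2 The quadratic bound (44) uniformly in the background: the letter `hquad` -/

include hL hG hU₀ hα hα3 hα8 h52 hρ' hρ hsmall' hc₃' hρ'1 hsmall hc₃ in
/-- **(44)/(135) UNIFORMLY IN THE BACKGROUND OF THE CHART** («Proposition 4 holds uniformly in A′»): for `‖u‖ < ρ′`, `‖Y‖ < ρ`, `j ≤ k`,
`‖C_j(e^{ins u}U₀, ins_S Y)‖ ≤ C₂‖Y‖²` with `C₂ = 8C₁′e^{E(ρ′)}(Lʲ)²` independent of `u` ([4] (130) at the complex background,
`B7Prop7Ins.prop7_prop4_uniform_ins`, componentwise; sup norm over `T`). [cite: Balaban1985Variational, (44) p.285, p.287]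
[cite: Balaban1985Averaging, Proposition 7 p.43, (130) p.38, (135) p.38] -/
theorem norm_Cmap₂_le {j : ℕ} (hj : j ≤ k) {u : S' → 𝔸} (hu : ‖u‖ < ρ') {Y : S → 𝔸} (hY : ‖Y‖ < ρ) :
    ‖Cmap L (expCfg (insCfg S' u) * U₀) S T j Y‖ ≤
      (8 * (2097152 * ((d : ℝ) + 1) ^ 2)
          * Real.exp (4480 * ((d : ℝ) + 1) ^ 2 * ((d : ℝ) + 4) * α₀ + 240000 * ((d : ℝ) + 1) ^ 3 * ((L : ℝ) ^ k * ρ'))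
          * ((L : ℝ) ^ j) ^ 2) * ‖Y‖ ^ 2 := by
  have hu' : ∀ s, ‖u s‖ < ρ' := fun s => lt_of_le_of_lt (norm_le_pi_norm u s) hu
  have hY' : ∀ s, ‖Y s‖ < ρ := fun s => lt_of_le_of_lt (norm_le_pi_norm Y s) hY
  refine (pi_norm_le_iff_of_nonneg (by positivity)).2 fun c => ?_
  have h := (prop7_prop4_uniform_ins S' S L hL hG k U₀ hU₀ hα hα3 hα8 h52 hρ' hρ hsmall' hc₃' hρ'1 hsmall hc₃ (u, Y) ⟨hu', hY'⟩
    j hj c.1.1 c.1.2).1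
  refine h.trans (le_of_eq ?_)
  ring

include hL hG hU₀ hα hα3 hα8 h52 hρ' hρ hsmall' hc₃' hρ'1 hsmall hc₃ in
/-- **EACH BACKGROUND OF THE CHART IS A `QuadAnalytic` DATUM** of the Sect. C scheme (`B13Contraction113`): for `‖u‖ < ρ′`, `j ≤ k`,
`QuadAnalytic (Cmap L (e^{ins u}U₀) S T j) C₂ ρ` (`B11Rem287U0Analytic.quadAnalytic_section` at the concrete letters).
[cite: Balaban1985Variational, (44) p.285, p.287] -/
theorem quadAnalytic_Cmap₂ {j : ℕ} (hj : j ≤ k) {u : S' → 𝔸} (hu : ‖u‖ < ρ') :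
    QuadAnalytic (Cmap L (expCfg (insCfg S' u) * U₀) S T j)
      (8 * (2097152 * ((d : ℝ) + 1) ^ 2)
          * Real.exp (4480 * ((d : ℝ) + 1) ^ 2 * ((d : ℝ) + 4) * α₀ + 240000 * ((d : ℝ) + 1) ^ 3 * ((L : ℝ) ^ k * ρ'))
          * ((L : ℝ) ^ j) ^ 2) ρ :=
  quadAnalytic_section (𝒪 := {u : S' → 𝔸 | ‖u‖ < ρ'}) (C := fun u Y => Cmap L (expCfg (insCfg S' u) * U₀) S T j Y)
    (analyticOnNhd_Cmap₂ S' S T L hL hG k U₀ hU₀ hα hα3 hα8 h52 hρ' hρ hsmall' hc₃' hρ'1 hsmall hc₃ hj)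
    (fun _ hu _ hY => norm_Cmap₂_le S' S T L hL hG k U₀ hU₀ hα hα3 hα8 h52 hρ' hρ hsmall' hc₃' hρ'1 hsmall hc₃ hj hu hY) hu

/-! ## §3 The remark for the concrete `C_j`: `U₀ ↦ D(U₀, A′)` is analytic on the domain of `H(U₀)` -/

variable (H : (S' → 𝔸) → ((T → 𝔸) →L[ℂ] (S → 𝔸))) {B₀ ε : ℝ}

include hL hG hU₀ hα hα3 hα8 h52 hρ' hρ hsmall' hc₃' hρ'1 hsmall hc₃ in
/-- **EXISTENCE OF THE FAMILY OF FIXED POINTS FOR THE CONCRETE `C_j`**: for every operator family `H` with `‖H(u)‖ ≤ B₀` on `𝒪` (analyticity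
of `H` is not needed here), in the regime «9C₂B₀ε < 1», `3ε ≤ ρ`, there is a selector `D(u, A′)` solving (49) `C_j(e^{ins u}U₀, A′ − H(u)D(u, A′)) =
D(u, A′)` with (55) `‖D(u, A′)‖ ≤ 4C₂ε²` for `u ∈ 𝒪`, `‖A′‖ < ε` (`B11Rem287U0Analytic.exists_D`). [cite: Balaban1985Variational, (49)–(55) pp.285–286, p.287] -/
theorem exists_D_concrete {j : ℕ} (hj : j ≤ k) (hHB : ∀ u ∈ {u : S' → 𝔸 | ‖u‖ < ρ'}, ‖H u‖ ≤ B₀) (hB₀ : 0 ≤ B₀)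
    (hq : 9 * (8 * (2097152 * ((d : ℝ) + 1) ^ 2)
          * Real.exp (4480 * ((d : ℝ) + 1) ^ 2 * ((d : ℝ) + 4) * α₀ + 240000 * ((d : ℝ) + 1) ^ 3 * ((L : ℝ) ^ k * ρ'))
          * ((L : ℝ) ^ j) ^ 2) * B₀ * ε < 1) (hRC : 3 * ε ≤ ρ) :
    ∃ D : (S' → 𝔸) → (S → 𝔸) → (T → 𝔸), ∀ u ∈ {u : S' → 𝔸 | ‖u‖ < ρ'}, ∀ A : S → 𝔸, ‖A‖ < ε →
      D u A ∈ closedBall (0 : T → 𝔸) (4 * (8 * (2097152 * ((d : ℝ) + 1) ^ 2)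
          * Real.exp (4480 * ((d : ℝ) + 1) ^ 2 * ((d : ℝ) + 4) * α₀ + 240000 * ((d : ℝ) + 1) ^ 3 * ((L : ℝ) ^ k * ρ'))
          * ((L : ℝ) ^ j) ^ 2) * ε ^ 2) ∧
        Cmap L (expCfg (insCfg S' u) * U₀) S T j (A - H u (D u A)) = D u A :=
  exists_D (𝒪 := {u : S' → 𝔸 | ‖u‖ < ρ'}) (C := fun u Y => Cmap L (expCfg (insCfg S' u) * U₀) S T j Y) (H := H)
    (analyticOnNhd_Cmap₂ S' S T L hL hG k U₀ hU₀ hα hα3 hα8 h52 hρ' hρ hsmall' hc₃' hρ'1 hsmall hc₃ hj)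
    (fun _ hu _ hY => norm_Cmap₂_le S' S T L hL hG k U₀ hU₀ hα hα3 hα8 h52 hρ' hρ hsmall' hc₃' hρ'1 hsmall hc₃ hj hu hY)
    hHB (by positivity) hB₀ hq hRC

variable {D : (S' → 𝔸) → (S → 𝔸) → (T → 𝔸)}

include hL hG hU₀ hα hα3 hα8 h52 hρ' hρ hsmall' hc₃' hρ'1 hsmall hc₃ in
/-- **`D` IS JOINTLY ANALYTIC IN (BACKGROUND, FIELD) FOR THE CONCRETE `C_j`**: for every operator family `H` analytic on `𝒪 = {‖u‖ < ρ′}` with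
`‖H(u)‖ ≤ B₀` there ([5], hypotheses), in the regime «9C₂B₀ε < 1», `3ε ≤ ρ`, every selector family `D(u, A′)` with (49)+(55) on `𝒪 ×ˢ {‖A′‖ < ε}`
is analytic on a neighbourhood of every point of `𝒪 ×ˢ {‖A′‖ < ε}` (`B11Rem287U0Analytic.analyticOnNhd_D` at the concrete letters of §1–§2).
[cite: Balaban1985Variational, p.287] [cite: Balaban1985Averaging, Proposition 7 p.43] -/
theorem analyticOnNhd_D_concrete {j : ℕ} (hj : j ≤ k) (hHa : AnalyticOnNhd ℂ H {u : S' → 𝔸 | ‖u‖ < ρ'})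
    (hHB : ∀ u ∈ {u : S' → 𝔸 | ‖u‖ < ρ'}, ‖H u‖ ≤ B₀) (hB₀ : 0 ≤ B₀)
    (hq : 9 * (8 * (2097152 * ((d : ℝ) + 1) ^ 2)
          * Real.exp (4480 * ((d : ℝ) + 1) ^ 2 * ((d : ℝ) + 4) * α₀ + 240000 * ((d : ℝ) + 1) ^ 3 * ((L : ℝ) ^ k * ρ'))
          * ((L : ℝ) ^ j) ^ 2) * B₀ * ε < 1) (hRC : 3 * ε ≤ ρ)
    (hDball : ∀ u ∈ {u : S' → 𝔸 | ‖u‖ < ρ'}, ∀ A : S → 𝔸, ‖A‖ < ε →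
      D u A ∈ closedBall (0 : T → 𝔸) (4 * (8 * (2097152 * ((d : ℝ) + 1) ^ 2)
          * Real.exp (4480 * ((d : ℝ) + 1) ^ 2 * ((d : ℝ) + 4) * α₀ + 240000 * ((d : ℝ) + 1) ^ 3 * ((L : ℝ) ^ k * ρ'))
          * ((L : ℝ) ^ j) ^ 2) * ε ^ 2))
    (hDfix : ∀ u ∈ {u : S' → 𝔸 | ‖u‖ < ρ'}, ∀ A : S → 𝔸, ‖A‖ < ε →
      Cmap L (expCfg (insCfg S' u) * U₀) S T j (A - H u (D u A)) = D u A) :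
    AnalyticOnNhd ℂ (fun p : (S' → 𝔸) × (S → 𝔸) => D p.1 p.2) ({u : S' → 𝔸 | ‖u‖ < ρ'} ×ˢ ball (0 : S → 𝔸) ε) :=
  analyticOnNhd_D (𝒪 := {u : S' → 𝔸 | ‖u‖ < ρ'}) (C := fun u Y => Cmap L (expCfg (insCfg S' u) * U₀) S T j Y) (H := H)
    (isOpen_lt continuous_norm continuous_const)
    (analyticOnNhd_Cmap₂ S' S T L hL hG k U₀ hU₀ hα hα3 hα8 h52 hρ' hρ hsmall' hc₃' hρ'1 hsmall hc₃ hj)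
    (fun _ hu _ hY => norm_Cmap₂_le S' S T L hL hG k U₀ hU₀ hα hα3 hα8 h52 hρ' hρ hsmall' hc₃' hρ'1 hsmall hc₃ hj hu hY)
    hHa hHB (by positivity) hB₀ hq hRC hDball hDfix

include hL hG hU₀ hα hα3 hα8 h52 hρ' hρ hsmall' hc₃' hρ'1 hsmall hc₃ in
/-- **«IT IS AN ANALYTIC FUNCTION OF U₀ … D(A′) HAS THE SAME ANALYTICITY DOMAIN AS H(U₀)», CONCRETE `C_j`**: for each fixed field `A′` with
`‖A′‖ < ε`, the background dependence `u ↦ D(u, A′)` (chart `U₀ ↦ e^{ins u}U₀`) is analytic on the WHOLE domain `𝒪 = {‖u‖ < ρ′}` on which the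
operator family `H` is analytic and bounded (`B11Rem287U0Analytic.analyticOnNhd_D_background`). [cite: Balaban1985Variational, p.287]
[cite: Balaban1985Averaging, Proposition 7 p.43] -/
theorem analyticOnNhd_D_background_concrete {j : ℕ} (hj : j ≤ k) (hHa : AnalyticOnNhd ℂ H {u : S' → 𝔸 | ‖u‖ < ρ'})
    (hHB : ∀ u ∈ {u : S' → 𝔸 | ‖u‖ < ρ'}, ‖H u‖ ≤ B₀) (hB₀ : 0 ≤ B₀)
    (hq : 9 * (8 * (2097152 * ((d : ℝ) + 1) ^ 2)
          * Real.exp (4480 * ((d : ℝ) + 1) ^ 2 * ((d : ℝ) + 4) * α₀ + 240000 * ((d : ℝ) + 1) ^ 3 * ((L : ℝ) ^ k * ρ'))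
          * ((L : ℝ) ^ j) ^ 2) * B₀ * ε < 1) (hRC : 3 * ε ≤ ρ)
    (hDball : ∀ u ∈ {u : S' → 𝔸 | ‖u‖ < ρ'}, ∀ A : S → 𝔸, ‖A‖ < ε →
      D u A ∈ closedBall (0 : T → 𝔸) (4 * (8 * (2097152 * ((d : ℝ) + 1) ^ 2)
          * Real.exp (4480 * ((d : ℝ) + 1) ^ 2 * ((d : ℝ) + 4) * α₀ + 240000 * ((d : ℝ) + 1) ^ 3 * ((L : ℝ) ^ k * ρ'))
          * ((L : ℝ) ^ j) ^ 2) * ε ^ 2))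
    (hDfix : ∀ u ∈ {u : S' → 𝔸 | ‖u‖ < ρ'}, ∀ A : S → 𝔸, ‖A‖ < ε →
      Cmap L (expCfg (insCfg S' u) * U₀) S T j (A - H u (D u A)) = D u A) {A₀ : S → 𝔸} (hA₀ : ‖A₀‖ < ε) :
    AnalyticOnNhd ℂ (fun u : S' → 𝔸 => D u A₀) {u : S' → 𝔸 | ‖u‖ < ρ'} :=
  analyticOnNhd_D_background (𝒪 := {u : S' → 𝔸 | ‖u‖ < ρ'}) (C := fun u Y => Cmap L (expCfg (insCfg S' u) * U₀) S T j Y) (H := H)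
    (isOpen_lt continuous_norm continuous_const)
    (analyticOnNhd_Cmap₂ S' S T L hL hG k U₀ hU₀ hα hα3 hα8 h52 hρ' hρ hsmall' hc₃' hρ'1 hsmall hc₃ hj)
    (fun _ hu _ hY => norm_Cmap₂_le S' S T L hL hG k U₀ hU₀ hα hα3 hα8 h52 hρ' hρ hsmall' hc₃' hρ'1 hsmall hc₃ hj hu hY)
    hHa hHB (by positivity) hB₀ hq hRC hDball hDfix hA₀

include hL hG hU₀ hα hα3 hα8 h52 hρ' hρ hsmall' hc₃' hρ'1 hsmall hc₃ in
/-- **«AN ANALYTIC FUNCTION OF A′»** recovered per background of the chart from the joint statement (`B11Rem287U0Analytic.analyticOnNhd_D_field`;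
cf. `B11Eq44Concrete.analytic_fixedPoint_concrete` at a fixed background). [cite: Balaban1985Variational, p.287, p.286] -/
theorem analyticOnNhd_D_field_concrete {j : ℕ} (hj : j ≤ k) (hHa : AnalyticOnNhd ℂ H {u : S' → 𝔸 | ‖u‖ < ρ'})
    (hHB : ∀ u ∈ {u : S' → 𝔸 | ‖u‖ < ρ'}, ‖H u‖ ≤ B₀) (hB₀ : 0 ≤ B₀)
    (hq : 9 * (8 * (2097152 * ((d : ℝ) + 1) ^ 2)
          * Real.exp (4480 * ((d : ℝ) + 1) ^ 2 * ((d : ℝ) + 4) * α₀ + 240000 * ((d : ℝ) + 1) ^ 3 * ((L : ℝ) ^ k * ρ'))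
          * ((L : ℝ) ^ j) ^ 2) * B₀ * ε < 1) (hRC : 3 * ε ≤ ρ)
    (hDball : ∀ u ∈ {u : S' → 𝔸 | ‖u‖ < ρ'}, ∀ A : S → 𝔸, ‖A‖ < ε →
      D u A ∈ closedBall (0 : T → 𝔸) (4 * (8 * (2097152 * ((d : ℝ) + 1) ^ 2)
          * Real.exp (4480 * ((d : ℝ) + 1) ^ 2 * ((d : ℝ) + 4) * α₀ + 240000 * ((d : ℝ) + 1) ^ 3 * ((L : ℝ) ^ k * ρ'))
          * ((L : ℝ) ^ j) ^ 2) * ε ^ 2))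
    (hDfix : ∀ u ∈ {u : S' → 𝔸 | ‖u‖ < ρ'}, ∀ A : S → 𝔸, ‖A‖ < ε →
      Cmap L (expCfg (insCfg S' u) * U₀) S T j (A - H u (D u A)) = D u A) {u₀ : S' → 𝔸} (hu₀ : ‖u₀‖ < ρ') :
    AnalyticOnNhd ℂ (D u₀) (ball (0 : S → 𝔸) ε) :=
  analyticOnNhd_D_field (𝒪 := {u : S' → 𝔸 | ‖u‖ < ρ'}) (C := fun u Y => Cmap L (expCfg (insCfg S' u) * U₀) S T j Y) (H := H)
    (isOpen_lt continuous_norm continuous_const)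
    (analyticOnNhd_Cmap₂ S' S T L hL hG k U₀ hU₀ hα hα3 hα8 h52 hρ' hρ hsmall' hc₃' hρ'1 hsmall hc₃ hj)
    (fun _ hu _ hY => norm_Cmap₂_le S' S T L hL hG k U₀ hU₀ hα hα3 hα8 h52 hρ' hρ hsmall' hc₃' hρ'1 hsmall hc₃ hj hu hY)
    hHa hHB (by positivity) hB₀ hq hRC hDball hDfix hu₀

include hL hG hU₀ hα hα3 hα8 h52 hρ' hρ hsmall' hc₃' hρ'1 hsmall hc₃ in
/-- **THE REMARK FOR r08's CANONICAL SELECTOR**: `u ↦ Dfix (C_j(e^{ins u}U₀, ·)) (H u) C₂ A′` (`B11Prop3Model.Dfix`, THE solution of (49) in the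
(55)-ball at each background, `Dfix_ball`/`Dfix_fix` at the `QuadAnalytic` data of §2) is analytic on `𝒪 = {‖u‖ < ρ′}` for every `‖A′‖ < ε` —
«D(A′) … is an analytic function of U₀ … [with] the same analyticity domain as H(U₀)». [cite: Balaban1985Variational, p.287, (49) p.285, (55) p.286] -/
theorem analyticOnNhd_Dfix_background_concrete {j : ℕ} (hj : j ≤ k) (hHa : AnalyticOnNhd ℂ H {u : S' → 𝔸 | ‖u‖ < ρ'})
    (hHB : ∀ u ∈ {u : S' → 𝔸 | ‖u‖ < ρ'}, ‖H u‖ ≤ B₀) (hB₀ : 0 ≤ B₀)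
    (hq : 9 * (8 * (2097152 * ((d : ℝ) + 1) ^ 2)
          * Real.exp (4480 * ((d : ℝ) + 1) ^ 2 * ((d : ℝ) + 4) * α₀ + 240000 * ((d : ℝ) + 1) ^ 3 * ((L : ℝ) ^ k * ρ'))
          * ((L : ℝ) ^ j) ^ 2) * B₀ * ε < 1) (hRC : 3 * ε ≤ ρ) {A₀ : S → 𝔸} (hA₀ : ‖A₀‖ < ε) :
    AnalyticOnNhd ℂ (fun u : S' → 𝔸 =>
        Dfix (Cmap L (expCfg (insCfg S' u) * U₀) S T j) (H u : (T → 𝔸) →ₗ[ℂ] (S → 𝔸))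
          (8 * (2097152 * ((d : ℝ) + 1) ^ 2)
            * Real.exp (4480 * ((d : ℝ) + 1) ^ 2 * ((d : ℝ) + 4) * α₀ + 240000 * ((d : ℝ) + 1) ^ 3 * ((L : ℝ) ^ k * ρ'))
            * ((L : ℝ) ^ j) ^ 2) A₀)
      {u : S' → 𝔸 | ‖u‖ < ρ'} := by
  have hC₂ : (0 : ℝ) ≤ 8 * (2097152 * ((d : ℝ) + 1) ^ 2)
      * Real.exp (4480 * ((d : ℝ) + 1) ^ 2 * ((d : ℝ) + 4) * α₀ + 240000 * ((d : ℝ) + 1) ^ 3 * ((L : ℝ) ^ k * ρ'))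
      * ((L : ℝ) ^ j) ^ 2 := by positivity
  have hHB' : ∀ u ∈ {u : S' → 𝔸 | ‖u‖ < ρ'}, ∀ X : T → 𝔸, ‖(H u : (T → 𝔸) →ₗ[ℂ] (S → 𝔸)) X‖ ≤ B₀ * ‖X‖ :=
    fun u hu => hHop_of_opNorm (hHB u hu)
  refine analyticOnNhd_D_background_concrete S' S T L hL hG k U₀ hU₀ hα hα3 hα8 h52 hρ' hρ hsmall' hc₃' hρ'1 hsmall hc₃ H hj hHa hHB
    hB₀ hq hRC
    (D := fun u A => Dfix (Cmap L (expCfg (insCfg S' u) * U₀) S T j) (H u : (T → 𝔸) →ₗ[ℂ] (S → 𝔸))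
      (8 * (2097152 * ((d : ℝ) + 1) ^ 2)
        * Real.exp (4480 * ((d : ℝ) + 1) ^ 2 * ((d : ℝ) + 4) * α₀ + 240000 * ((d : ℝ) + 1) ^ 3 * ((L : ℝ) ^ k * ρ'))
        * ((L : ℝ) ^ j) ^ 2) A)
    (fun u hu A hA => Dfix_ball (quadAnalytic_Cmap₂ S' S T L hL hG k U₀ hU₀ hα hα3 hα8 h52 hρ' hρ hsmall' hc₃' hρ'1 hsmall hc₃ hj hu)
      hC₂ hB₀ (hHB' u hu) hq hRC A hA)
    (fun u hu A hA => by
      simpa using Dfix_fix (quadAnalytic_Cmap₂ S' S T L hL hG k U₀ hU₀ hα hα3 hα8 h52 hρ' hρ hsmall' hc₃' hρ'1 hsmall hc₃ hj hu)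
        hC₂ hB₀ (hHB' u hu) hq hRC A hA)
    hA₀

end Polydisc

end Literature.MathematicalPhysics.QuantumFieldTheory.Balaban1983to89.B11Rem287U0Concrete

end
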